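import Summits.BirchSwinnertonDyer.BirchSwinnertonDyer.Theorems.ManinLocalTwoThreeKummerSquareRootSigmaDictionary
import Summits.BirchSwinnertonDyer.BirchSwinnertonDyer.Theorems.ManinLocalTwoThreeStevensCurveOfCuspZero
import HarnessLib

/-!
# The ℓ = 2 KUMMER-CHARACTER ENDGAME: if the `σ`-square root of `x − x(T)` is `Γ₁(N)`-automorphic then `Λ₁(f) ≠ Λ₀(f)` — hence (cusp facts)
# the curve has ANALYTIC RANK `0` and ROOT NUMBER `+1`; the lattice step that closes a «UDC line at ℓ = 2» on the odd-rank half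
(route `ManinLocalTwoThree`, deciding crux C2 `ManinOddAtFour` stmt-BirchSwinnertonDyer-22967; cell bsd-f2-manin, C2/C3 LEAD p1 gen 18;
`--supports stmt-BirchSwinnertonDyer-22967`; LEAD-MEMO v35 §3 «v24 design»; the ℓ = 2 twin of the ℓ = 3 DICTΣ/Kummer–Shimura step `kummerShimuraLattice_holds`)

THE SETTING (p2 g16/g17, `…SigmaSquareRootLeaves`, `…KummerSquareRootSigmaDictionary`).  `D` a lattice-optimal `X₀(N)`-datum (`Λ := Λ_W = c·Λ₀(f)`),
`a ∉ Λ` a half-period (`2a = m₁ω₁ + m₂ω₂`; `a ↔` a `2`-torsion point `T`, S6₂), `V = sigmaSqRoot Λ a e` (`e = m₁η₁ + m₂η₂`) the `σ`-square root of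
`x − x(T)` (S3₂), `G₂ = t_s·V(c·E_f)` its pull-back to `ℍ` — the analytic germ of `√Ξ_T` (p2's `exists_hasSum_const_mul_shortT_mul_sigmaSqRoot`).  A
prospective UDC line at `ℓ = 2` runs: `2 ∣ c` ⟹ `√Ξ_T ∈ Frac ℤ₂⟦q⟧` (E-an-47) ⟹ bounded denominators ⟹ (Calegari–Dimitrov–Tang) `G₂` is modular for a
congruence group ⟹ (Kummer-cover analysis) `G₂(γτ) = G₂(τ)` for all `γ ∈ Γ₁(N)`.  THIS FILE is the LATTICE ENDGAME after that point (all UNCONDITIONAL,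
resp. mod the printed cusp facts where said):
* §1 **`sigmaSqRoot_periodic_of_mem_periodLatticeGamma1`**: if `V` is periodic under `c·{∞,γ∞}_f` for every `γ ∈ Γ₁(N)` then under all of `c·Λ₁(f)`
  (the periods of `V` form a group);
* §2 **`periodLatticeGamma1_ne_of_sigmaSqRoot_gamma1_periodic`** — hence `Λ₁(f) ≠ Λ₀(f)` (else `V` would be periodic under `Λ = c·Λ₀ = c·Λ₁`, contradicting S3b₂
  `sigmaSqRoot_not_periodic`: the multipliers of `V` on `Λ` are the Weil pairing `e₂(T, ·) ≢ 1`); the `G₂`-form **`…_of_gamma1_automorphic`** via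
  `forall_gamma_smul_eq_iff_sigmaSqRoot_periodic`;
* §3 with the LEAD's `…StevensCurveOfCuspZero` (mod F★, F♮, CES): Γ₁(N)-automorphy of `G₂` forces **`{∞,0}_f ∉ Λ₀(f)`** (`L(f,1) ≠ 0`, analytic rank `0`),
  **`w_N f = −f`** (`frickeEigenvalue f ≠ 1`) and, at the conductor level, **ROOT NUMBER `+1`** — so on the root-number-`−1` half the UDC conclusion
  «`G₂` is `Γ₁(N)`-automorphic» is CONTRADICTORY, i.e. a completed ℓ = 2 UDC chain proves C2 there outright (LEAD-MEMO v35 §3).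
HONEST FRAMING: lattice/σ-function algebra; no step of the ℓ = 2 UDC chain before the endgame is proved here (E-an-47 is theorem-grade per -an; BI₂, the
holomorphic extension, growth at the cusps and the Kummer-cover analysis at ℓ = 2 are NOT in the tree); C2, Manin's conjecture and BSD are NOT proved.
No definitions, no named facts, no sorry.
[cite: WhittakerWatson1927, §20.421 (quasi-periodicity of σ), §20.411 (Legendre)] [cite: SilvermanAEC2009, III.8 (Weil pairing as σ-multiplier; shape)]
[cite: Stevens1989, §2] [cite: CalegariDimitrovTang2025, Thm. 1.0.1 (the intended input upstream of this endgame; not used here)]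
-/

set_option autoImplicit false
-- lint-debt: the directory name repeats the summit name (sibling precedent `ManinLocalTwoThreeKummerSquareRootSigmaDictionary.lean`)
set_option linter.dupNamespace false

noncomputable section

open scoped MatrixGroups ModularForm PeriodPair
open CongruenceSubgroup Complex
open WeierstrassCurve Literature.NumberTheory.EllipticCurves Literature.NumberTheory.EllipticCurves.ModularForms
open Summit.BirchSwinnertonDyer.Rank1Residual.ManinAdditive.CuspidalKummer
open Summit.BirchSwinnertonDyer.Rank1Residual.ManinAdditive.KummerCubeMonodromy
open Summit.BirchSwinnertonDyer.BirchSwinnertonDyer.Theorems.ManinLocalTwoThree.SigmaSquareRoot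
open Summit.BirchSwinnertonDyer.BirchSwinnertonDyer.Theorems.ManinLocalTwoThree.KummerSquareRootDictionary

namespace Summit.BirchSwinnertonDyer.BirchSwinnertonDyer.Theorems.ManinLocalTwoThree.SigmaHabitat

/-! ## §1 The periods of the `σ`-square root coming from `Γ₁(N)` -/

variable {W : WeierstrassCurve ℚ} {N : ℕ} [NeZero N]

/-- **`V` is periodic under `c·Λ₁(f)` when the ℓ = 2 Kummer character kills `Γ₁(N)`**: if `V = sigmaSqRoot Λ a e` is periodic under `c·{∞,γ∞}_f` for
every `γ ∈ Γ₁(N)` then under `c·z` for every `z ∈ Λ₁(f)` (the periods of `V` form a group; closure). [cite: Stevens1989, §2] [cite: WhittakerWatson1927, §20.421] -/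
theorem sigmaSqRoot_periodic_of_mem_periodLatticeGamma1 (D : ModularParametrizationData W N) (a e : ℂ)
    (hper : ∀ γ : Gamma1 N, ∀ w : ℂ,
      sigmaSqRoot D.L a e (w + (D.c : ℂ) * cuspSymbol D.f ⟨(γ : SL(2, ℤ)), Gamma1_in_Gamma0 N γ.2⟩) = sigmaSqRoot D.L a e w) :
    ∀ z ∈ periodLatticeGamma1 D.f, ∀ w : ℂ, sigmaSqRoot D.L a e (w + (D.c : ℂ) * z) = sigmaSqRoot D.L a e w := by
  intro z hz
  induction hz using AddSubgroup.closure_induction with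
  | mem x hx =>
    obtain ⟨γ, rfl⟩ := hx
    exact hper γ
  | zero => intro w; rw [mul_zero, add_zero]
  | add x y _ _ hx hy =>
    intro w
    rw [mul_add, show w + ((D.c : ℂ) * x + (D.c : ℂ) * y) = (w + (D.c : ℂ) * x) + (D.c : ℂ) * y by ring, hy, hx]
  | neg x _ hx =>
    intro w
    have h := hx (w + (D.c : ℂ) * -x)
    rw [show w + (D.c : ℂ) * -x + (D.c : ℂ) * x = w by ring] at h
    exact h.symm

/-! ## §2 Γ₁(N)-periodicity forces `Λ₁(f) ≠ Λ₀(f)` -/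

/-- **THE ℓ = 2 ENDGAME (lattice form).**  `D` lattice-optimal, `a ∉ Λ_W` a half-period (`2a = m₁ω₁ + m₂ω₂`), `V = sigmaSqRoot Λ_W a (m₁η₁ + m₂η₂)`.  If `V` is
periodic under `c·{∞,γ∞}_f` for every `γ ∈ Γ₁(N)`, then `Λ₁(f) ≠ Λ₀(f)` (else `Λ_W = c·Λ₀ = c·Λ₁ ⊆ periods(V)`, contradicting S3b₂).
[cite: Stevens1989, §2] [cite: WhittakerWatson1927, §20.421] -/
theorem periodLatticeGamma1_ne_of_sigmaSqRoot_gamma1_periodic (D : ModularParametrizationData W N)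
    (hopt : ∀ z ∈ D.L.lattice, ∃ w ∈ periodLattice D.f, z = D.c * w) {a : ℂ} {m₁ m₂ : ℤ} (ha : a ∉ D.L.lattice)
    (h2a : 2 * a = m₁ * D.L.ω₁ + m₂ * D.L.ω₂)
    (hper : ∀ γ : Gamma1 N, ∀ w : ℂ,
      sigmaSqRoot D.L a (m₁ * D.L.η₁ + m₂ * D.L.η₂) (w + (D.c : ℂ) * cuspSymbol D.f ⟨(γ : SL(2, ℤ)), Gamma1_in_Gamma0 N γ.2⟩) =
        sigmaSqRoot D.L a (m₁ * D.L.η₁ + m₂ * D.L.η₂) w) :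
    periodLatticeGamma1 D.f ≠ periodLattice D.f := by
  intro heq
  obtain ⟨ω, hω, w, hw⟩ := sigmaSqRoot_not_periodic D.L ha h2a
  obtain ⟨z, hz, rfl⟩ := hopt ω hω
  rw [← heq] at hz
  exact hw (sigmaSqRoot_periodic_of_mem_periodLatticeGamma1 D a _ hper z hz w)

/-- **THE ℓ = 2 ENDGAME (automorphic form).**  If `G₂ = t_s·V(c·E_f)` is `Γ₁(N)`-AUTOMORPHIC (`G₂(γτ) = G₂(τ)` for all `γ ∈ Γ₁(N)`, all `τ`) then
`Λ₁(f) ≠ Λ₀(f)` (p2's `forall_gamma_smul_eq_iff_sigmaSqRoot_periodic` + §2). [cite: Stevens1989, §2] -/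
theorem periodLatticeGamma1_ne_of_gamma1_automorphic [W.IsElliptic] (D : ModularParametrizationData W N)
    (hopt : ∀ z ∈ D.L.lattice, ∃ w ∈ periodLattice D.f, z = D.c * w) {a : ℂ} {m₁ m₂ : ℤ} (ha : a ∉ D.L.lattice)
    (h2a : 2 * a = m₁ * D.L.ω₁ + m₂ * D.L.ω₂)
    (haut : ∀ γ : Gamma1 N, ∀ τ : UpperHalfPlane,
      shortT D (((γ : SL(2, ℤ))) • τ) *
          sigmaSqRoot D.L a (m₁ * D.L.η₁ + m₂ * D.L.η₂) ((D.c : ℂ) * eichlerIntegral D.f (((γ : SL(2, ℤ))) • τ)) =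
        shortT D τ * sigmaSqRoot D.L a (m₁ * D.L.η₁ + m₂ * D.L.η₂) ((D.c : ℂ) * eichlerIntegral D.f τ)) :
    periodLatticeGamma1 D.f ≠ periodLattice D.f := by
  have hc0 : D.c ≠ 0 := D.maninConstant_ne_zero_holds
  refine periodLatticeGamma1_ne_of_sigmaSqRoot_gamma1_periodic D hopt ha h2a fun γ ↦ ?_
  exact (forall_gamma_smul_eq_iff_sigmaSqRoot_periodic D hc0 ha _ ⟨(γ : SL(2, ℤ)), Gamma1_in_Gamma0 N γ.2⟩).mp (haut γ)

/-! ## §3 With the cusp facts: Γ₁(N)-automorphy forces analytic rank `0` and root number `+1` -/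

section CuspFacts

variable [W.IsElliptic] [W.IsGloballyMinimal]

/-- **Γ₁(N)-automorphy of `G₂` ⟹ `{∞,0}_f ∉ Λ₀(f)`** (the cusp `0` does NOT map to the origin; `L(f,1) ≠ 0`, analytic rank `0`) — modulo F★, F♮, CES.
[cite: Stevens1982, Thm. 1.3.1] [cite: ConradEdixhovenStein2003, §6.1.2] -/
theorem modularSymbol_zero_not_mem_of_gamma1_automorphic_of_print (hF : optimalGamma1Parametrization_cusp_rational)
    (hFnat : optimalGamma1Parametrization_cuspZero_galoisConjugate) (hCES : exists_optimal_gamma1ParametrizationData)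
    (D : ModularParametrizationData W N) (hopt : ∀ z ∈ D.L.lattice, ∃ w ∈ periodLattice D.f, z = D.c * w)
    {a : ℂ} {m₁ m₂ : ℤ} (ha : a ∉ D.L.lattice) (h2a : 2 * a = m₁ * D.L.ω₁ + m₂ * D.L.ω₂)
    (haut : ∀ γ : Gamma1 N, ∀ τ : UpperHalfPlane,
      shortT D (((γ : SL(2, ℤ))) • τ) *
          sigmaSqRoot D.L a (m₁ * D.L.η₁ + m₂ * D.L.η₂) ((D.c : ℂ) * eichlerIntegral D.f (((γ : SL(2, ℤ))) • τ)) =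
        shortT D τ * sigmaSqRoot D.L a (m₁ * D.L.η₁ + m₂ * D.L.η₂) ((D.c : ℂ) * eichlerIntegral D.f τ)) :
    modularSymbol D.f 0 ∉ periodLattice D.f :=
  modularSymbol_zero_not_mem_of_ne_of_print hF hFnat hCES D hopt (periodLatticeGamma1_ne_of_gamma1_automorphic D hopt ha h2a haut)

/-- **Γ₁(N)-automorphy of `G₂` ⟹ `w_N f = −f`** (`frickeEigenvalue f ≠ 1`, i.e. `= −1`) — modulo F★, F♮, CES. [cite: AtkinLehner1970, Thm. 3] -/
theorem frickeEigenvalue_eq_neg_one_of_gamma1_automorphic_of_print (hF : optimalGamma1Parametrization_cusp_rational)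
    (hFnat : optimalGamma1Parametrization_cuspZero_galoisConjugate) (hCES : exists_optimal_gamma1ParametrizationData)
    (D : ModularParametrizationData W N) (hopt : ∀ z ∈ D.L.lattice, ∃ w ∈ periodLattice D.f, z = D.c * w)
    {a : ℂ} {m₁ m₂ : ℤ} (ha : a ∉ D.L.lattice) (h2a : 2 * a = m₁ * D.L.ω₁ + m₂ * D.L.ω₂)
    (haut : ∀ γ : Gamma1 N, ∀ τ : UpperHalfPlane,
      shortT D (((γ : SL(2, ℤ))) • τ) *
          sigmaSqRoot D.L a (m₁ * D.L.η₁ + m₂ * D.L.η₂) ((D.c : ℂ) * eichlerIntegral D.f (((γ : SL(2, ℤ))) • τ)) =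
        shortT D τ * sigmaSqRoot D.L a (m₁ * D.L.η₁ + m₂ * D.L.η₂) ((D.c : ℂ) * eichlerIntegral D.f τ)) :
    frickeEigenvalue D.f = -1 := by
  rcases IsNewform0.frickeEigenvalue_eq_one_or_eq_neg_one_holds D.isNewformOf.1 with h1 | h1
  · exact absurd (periodLatticeGamma1_eq_of_frickeEigenvalue_eq_one_of_print hF hFnat hCES D hopt h1)
      (periodLatticeGamma1_ne_of_gamma1_automorphic D hopt ha h2a haut)
  · exact h1

/-- **Γ₁(N)-automorphy of `G₂` ⟹ ROOT NUMBER `+1`** (conductor level; modulo F★, F♮, CES): the conclusion of an ℓ = 2 UDC chain is IMPOSSIBLE for an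
optimal curve of odd analytic rank — there such a chain proves `2 ∤ c₀` outright. [cite: AtkinLehner1970, Thm. 3] [cite: Stevens1989, §2] -/
theorem rootNumber_eq_one_of_gamma1_automorphic_of_print [NeZero (W.conductorNorm ℤ)]
    (hF : optimalGamma1Parametrization_cusp_rational) (hFnat : optimalGamma1Parametrization_cuspZero_galoisConjugate)
    (hCES : exists_optimal_gamma1ParametrizationData) (D : ModularParametrizationData W (W.conductorNorm ℤ))
    (hopt : ∀ z ∈ D.L.lattice, ∃ w ∈ periodLattice D.f, z = D.c * w)
    {a : ℂ} {m₁ m₂ : ℤ} (ha : a ∉ D.L.lattice) (h2a : 2 * a = m₁ * D.L.ω₁ + m₂ * D.L.ω₂)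
    (haut : ∀ γ : Gamma1 (W.conductorNorm ℤ), ∀ τ : UpperHalfPlane,
      shortT D (((γ : SL(2, ℤ))) • τ) *
          sigmaSqRoot D.L a (m₁ * D.L.η₁ + m₂ * D.L.η₂) ((D.c : ℂ) * eichlerIntegral D.f (((γ : SL(2, ℤ))) • τ)) =
        shortT D τ * sigmaSqRoot D.L a (m₁ * D.L.η₁ + m₂ * D.L.η₂) ((D.c : ℂ) * eichlerIntegral D.f τ)) :
    W.rootNumber = 1 := by
  rcases W.rootNumber_eq_one_or with h | h
  · exact h
  · exact absurd (periodLatticeGamma1_eq_of_rootNumber_eq_neg_one_of_print hF hFnat hCES D hopt h)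
      (periodLatticeGamma1_ne_of_gamma1_automorphic D hopt ha h2a haut)

end CuspFacts

end Summit.BirchSwinnertonDyer.BirchSwinnertonDyer.Theorems.ManinLocalTwoThree.SigmaHabitat

end
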